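import Summits.Ventures.YMGap.FlowData.RectTubeGaugeInvariance
import Summits.Ventures.YMGap.FlowData.RectTubeTorelonEnvelope
import HarnessLib

/-!
# Venture YMGap, track Y3 FLOW-DATA — the matrix elements of the RECTANGULAR tube transfer operator against
# gauge-invariant test functions reduce to the UN-AVERAGED electric bilinear form; `‖T‖ ≥ e^{−|J| n P} c₀^N`
# (theorems only)

HONEST FRAMING: venture file of the cell `pub-ymgap` (QuantumFields programme), track Y3; the v2 (rectangular,
`FlowData/RectTubeTransferOperator.lean`) twin of `FlowData/TubeTransferBilinearReduction.lean`, a brick of the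
rectangular strong-coupling window.  Finite spatial torus `Π_i ℤ/(Ls i)`; no number, no row, nothing about limits,
the continuum or a mass gap.  General compact `G`, unitary continuous `ρ`.

* `rectElecSum_gauge_left_self` — `elec(a^E, E, b) = elec(a, 1, b)` (the temporal links act on the earlier slice);
* **`inner_rectTubeTransferOperator_eq_of_gaugeInvariant`** — for `φ` gauge invariant a.e.,
  `⟪φ, T g⟫ = ∫ φ(a) m(a) (∫ ∏_e e^{J Re tr ρ(b_e a_e⁻¹)} m(b) g(b) db) da`, `m = e^{J mag/2}` (two Fubini swaps over the
  compact temporal-link group, `a ↦ a^E`, Haar probability);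
* **`norm_rectTubeTransferOperator_ge`** — `e^{−|J| n P} c₀^N ≤ ‖T‖` (the empty Polyakov path,
  `RectTubeFluxNonAnnihilation.inner_rectTubeTransferOperator_pathState`).

References: M. Lüscher, Commun. Math. Phys. 54 (1977) 283 [cite: Luscher1977]; I. Montvay, G. Münster (1994) §3.2.6
[cite: MontvayMunster1994, §3.2.6].
-/

noncomputable section

open scoped BigOperators
open MeasureTheory Filter Function
open Literature.MathematicalPhysics.QuantumFieldTheory Literature.Analysis.OperatorTheory
open Literature.Barriers.QuantumFields
open Literature.MathematicalPhysics.QuantumLattice (RectTorusSite)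

namespace Summit.Ventures.YMGap.FlowData

section Reduction

variable {G : Type*} [Group G] [TopologicalSpace G] [IsTopologicalGroup G] [CompactSpace G]
  [MeasurableSpace G] [BorelSpace G] [SecondCountableTopology G] {n : ℕ} (ρ : G →* Matrix (Fin n) (Fin n) ℂ)
  (J : ℝ) {k : ℕ} {Ls : Fin k → ℕ} [∀ i, NeZero (Ls i)]

omit [TopologicalSpace G] [IsTopologicalGroup G] [CompactSpace G] [MeasurableSpace G] [BorelSpace G]
  [SecondCountableTopology G] in
/-- **The temporal links act on the earlier slice** (rectangular): `elec(a^E, E, b) = elec(a, 1, b)`. [cite: Luscher1977] -/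
theorem rectElecSum_gauge_left_self (E : RectTorusSite Ls → G) (a b : RectSlice Ls G) :
    rectElecSum (Ls := Ls) ρ (fun e => E e.1 * a e * (E (e.1 + Pi.single e.2 1))⁻¹) E b =
      rectElecSum (Ls := Ls) ρ a 1 b := by
  have h := rectElecSum_gauge_div (Ls := Ls) ρ E 1 a b
  have h1 : (fun e : RectTorusSite Ls × Fin k => (1 : RectTorusSite Ls → G) e.1 * b e *
      ((1 : RectTorusSite Ls → G) (e.1 + Pi.single e.2 1))⁻¹) = b := by
    funext e; simp only [Pi.one_apply, one_mul, inv_one, mul_one]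
  rwa [div_one, h1] at h

omit [CompactSpace G] [MeasurableSpace G] [BorelSpace G] [SecondCountableTopology G] in
/-- Continuity of `(a, E, b) ↦ e^{J elec(a,E,b)}`, as a function on `(a, E) × b`. [folklore] -/
theorem continuous_exp_rectElecSum_pair (hρ : Continuous ρ) :
    Continuous fun q : (RectSlice Ls G × (RectTorusSite Ls → G)) × RectSlice Ls G =>
      Real.exp (J * rectElecSum (Ls := Ls) ρ q.1.1 q.1.2 q.2) :=
  Real.continuous_exp.comp (continuous_const.mul (Continuous.comp
    (g := fun r : RectSlice Ls G × (RectTorusSite Ls → G) × RectSlice Ls G => rectElecSum (Ls := Ls) ρ r.1 r.2.1 r.2.2)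
    (f := fun q : (RectSlice Ls G × (RectTorusSite Ls → G)) × RectSlice Ls G => (q.1.1, q.1.2, q.2))
    (continuous_rectElecSum_triple ρ hρ)
    ((continuous_fst.comp continuous_fst).prodMk ((continuous_snd.comp continuous_fst).prodMk continuous_snd))))

omit [TopologicalSpace G] [IsTopologicalGroup G] [CompactSpace G] [MeasurableSpace G] [BorelSpace G]
  [SecondCountableTopology G] in
/-- `|e^{J elec(a,E,b)}| ≤ e^{|J| n N}` (unitary `ρ`, `N` links). [folklore] -/
theorem exp_rectElecSum_le (hρu : ∀ g, ρ g ∈ Matrix.unitaryGroup (Fin n) ℂ) (a b : RectSlice Ls G)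
    (E : RectTorusSite Ls → G) :
    Real.exp (J * rectElecSum (Ls := Ls) ρ a E b) ≤ Real.exp (|J| * (n * Fintype.card (RectTorusSite Ls × Fin k))) := by
  refine Real.exp_le_exp.2 ?_
  have h1 : |rectElecSum (Ls := Ls) ρ a E b| ≤ n * Fintype.card (RectTorusSite Ls × Fin k) := by
    unfold rectElecSum
    refine (Finset.abs_sum_le_sum_abs _ _).trans ?_
    have h : ∀ x : RectTorusSite Ls, |∑ i : Fin k, (ρ (E x * b (x, i) * (E (x + Pi.single i 1))⁻¹ * (a (x, i))⁻¹)).trace.re|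
        ≤ ∑ _i : Fin k, (n : ℝ) := fun x =>
      (Finset.abs_sum_le_sum_abs _ _).trans (Finset.sum_le_sum fun i _ =>
        (Complex.abs_re_le_norm _).trans (FiniteTemperature.norm_trace_le_of_mem_unitaryGroup (hρu _)))
    refine (Finset.sum_le_sum fun x _ => h x).trans (le_of_eq ?_)
    simp only [Finset.sum_const, Finset.card_univ, Fintype.card_prod]
    push_cast
    ring
  calc J * rectElecSum (Ls := Ls) ρ a E b ≤ |J * rectElecSum (Ls := Ls) ρ a E b| := le_abs_self _
    _ = |J| * |rectElecSum (Ls := Ls) ρ a E b| := abs_mul _ _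
    _ ≤ |J| * (n * Fintype.card (RectTorusSite Ls × Fin k)) := mul_le_mul_of_nonneg_left h1 (abs_nonneg _)

/-- **THE MATRIX ELEMENT AGAINST A GAUGE-INVARIANT TEST FUNCTION.**  For `φ, g ∈ L²(slice)` with `φ` gauge invariant
a.e. under every gauge transformation,
`⟪φ, T g⟫ = ∫ φ(a) m(a) (∫ ∏_e e^{J Re tr ρ(b_e a_e⁻¹)} m(b) g(b) db) da`, `m = e^{J mag/2}`: the temporal links are
absorbed into `φ` by `a ↦ a^E` and integrate to one. [cite: Luscher1977] [cite: MontvayMunster1994, §3.2.6] -/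
theorem inner_rectTubeTransferOperator_eq_of_gaugeInvariant (hρ : Continuous ρ)
    (hρu : ∀ g, ρ g ∈ Matrix.unitaryGroup (Fin n) ℂ) (φ g : Lp ℝ 2 (rectSliceMeasure G Ls))
    (hφ : ∀ γ : RectTorusSite Ls → G, ∀ᵐ a ∂(rectSliceMeasure G Ls),
      (φ : RectSlice Ls G → ℝ) (fun e => γ e.1 * a e * (γ (e.1 + Pi.single e.2 1))⁻¹) = (φ : RectSlice Ls G → ℝ) a) :
    @inner ℝ _ _ φ (rectTubeTransferOperator ρ J Ls g) =
      ∫ a, ((φ : RectSlice Ls G → ℝ) a * Real.exp (J / 2 * rectMagSum (Ls := Ls) ρ a)) *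
        ∫ b, (∏ e : RectTorusSite Ls × Fin k, Real.exp (J * (ρ (b e * (a e)⁻¹)).trace.re)) *
          (Real.exp (J / 2 * rectMagSum (Ls := Ls) ρ b) * (g : RectSlice Ls G → ℝ) b)
          ∂(rectSliceMeasure G Ls) ∂(rectSliceMeasure G Ls) := by
  set m : RectSlice Ls G → ℝ := fun a => Real.exp (J / 2 * rectMagSum (Ls := Ls) ρ a) with hm
  set h : RectSlice Ls G → ℝ := fun b => m b * (g : RectSlice Ls G → ℝ) b with hh
  have hmc : Continuous m := Real.continuous_exp.comp (continuous_const.mul (continuous_rectMagSum (Ls := Ls) ρ hρ))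
  obtain ⟨Cm, hCm⟩ := isCompact_univ.exists_bound_of_continuousOn hmc.continuousOn
  have hgi : Integrable (g : RectSlice Ls G → ℝ) (rectSliceMeasure G Ls) := (Lp.memLp g).integrable one_le_two
  have hφi : Integrable (φ : RectSlice Ls G → ℝ) (rectSliceMeasure G Ls) := (Lp.memLp φ).integrable one_le_two
  have hhi : Integrable h (rectSliceMeasure G Ls) := by
    have := hgi.bdd_mul hmc.aestronglyMeasurable (Eventually.of_forall fun b => hCm b (Set.mem_univ _))
    exact this
  have hφmi : Integrable (fun a => (φ : RectSlice Ls G → ℝ) a * m a) (rectSliceMeasure G Ls) :=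
    hφi.mul_bdd hmc.aestronglyMeasurable (Eventually.of_forall fun b => hCm b (Set.mem_univ _))
  set CE : ℝ := Real.exp (|J| * (n * Fintype.card (RectTorusSite Ls × Fin k))) with hCE
  have hexp_le : ∀ a b E, Real.exp (J * rectElecSum (Ls := Ls) ρ a E b) ≤ CE := fun a b E => exp_rectElecSum_le ρ J hρu a b E
  have hexp_nn : ∀ a b E, 0 ≤ Real.exp (J * rectElecSum (Ls := Ls) ρ a E b) := fun a b E => (Real.exp_pos _).le
  -- Step 0: the kernel formula
  rw [inner_kernelOp_eq_integral (rectTubeTransferOperator_ae_eq J Ls hρ) φ g]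
  -- Step 1: for fixed `a`, swap the `b` and `E` integrals
  set F : RectSlice Ls G → (RectTorusSite Ls → G) → ℝ := fun a E =>
    ∫ b, Real.exp (J * rectElecSum (Ls := Ls) ρ a E b) * h b ∂(rectSliceMeasure G Ls) with hF
  have hstep1 : ∀ a : RectSlice Ls G, ∫ b, rectSliceKernel (Ls := Ls) ρ J J a b * (g : RectSlice Ls G → ℝ) b ∂(rectSliceMeasure G Ls) =
      m a * ∫ E, F a E ∂(Measure.pi fun _ : RectTorusSite Ls => haarProbability G) := by
    intro a
    have h1 : ∀ b, rectSliceKernel (Ls := Ls) ρ J J a b * (g : RectSlice Ls G → ℝ) b =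
        m a * ∫ E, Real.exp (J * rectElecSum (Ls := Ls) ρ a E b) * h b ∂(Measure.pi fun _ : RectTorusSite Ls => haarProbability G) := by
      intro b
      simp only [rectSliceKernel, hh, hm]
      rw [integral_mul_const]
      ring
    simp_rw [h1]
    rw [integral_const_mul]
    congr 1
    -- Fubini on `μS × μE`
    have hc : Continuous fun p : RectSlice Ls G × (RectTorusSite Ls → G) =>
        Real.exp (J * rectElecSum (Ls := Ls) ρ a p.2 p.1) :=
      Continuous.comp (g := fun q : (RectSlice Ls G × (RectTorusSite Ls → G)) × RectSlice Ls G =>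
          Real.exp (J * rectElecSum (Ls := Ls) ρ q.1.1 q.1.2 q.2))
        (f := fun p : RectSlice Ls G × (RectTorusSite Ls → G) => ((a, p.2), p.1))
        (continuous_exp_rectElecSum_pair ρ J hρ) ((continuous_const.prodMk continuous_snd).prodMk continuous_fst)
    have hint : Integrable (uncurry fun (b : RectSlice Ls G) (E : RectTorusSite Ls → G) =>
        Real.exp (J * rectElecSum (Ls := Ls) ρ a E b) * h b) ((rectSliceMeasure G Ls).prod (Measure.pi fun _ : RectTorusSite Ls => haarProbability G)) := by
      have h0 : Integrable (fun p : RectSlice Ls G × (RectTorusSite Ls → G) => h p.1 * (1 : ℝ)) ((rectSliceMeasure G Ls).prod (Measure.pi fun _ : RectTorusSite Ls => haarProbability G)) :=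
        hhi.mul_prod (integrable_const 1)
      have h0' := h0.bdd_mul hc.aestronglyMeasurable (c := CE)
        (Eventually.of_forall fun p => by rw [Real.norm_of_nonneg (hexp_nn _ _ _)]; exact hexp_le _ _ _)
      refine h0'.congr (Eventually.of_forall fun p => ?_)
      simp only [uncurry, mul_one]
    exact integral_integral_swap hint
  simp_rw [hstep1]
  -- Step 2: swap the `a` and `E` integrals
  have hFc : Continuous (uncurry F) := by
    refine continuous_of_dominated (bound := fun b => CE * ‖h b‖) ?_ ?_ ?_ ?_
    · intro p
      exact (Continuous.comp (g := fun q : (RectSlice Ls G × (RectTorusSite Ls → G)) × RectSlice Ls G =>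
          Real.exp (J * rectElecSum (Ls := Ls) ρ q.1.1 q.1.2 q.2))
        (f := fun b : RectSlice Ls G => (p, b))
        (continuous_exp_rectElecSum_pair ρ J hρ) (continuous_const.prodMk continuous_id)).aestronglyMeasurable.mul
        hhi.aestronglyMeasurable
    · intro p
      refine Eventually.of_forall fun b => ?_
      rw [norm_mul, Real.norm_of_nonneg (hexp_nn _ _ _)]
      exact mul_le_mul_of_nonneg_right (hexp_le _ _ _) (norm_nonneg _)
    · exact hhi.norm.const_mul _
    · refine Eventually.of_forall fun b => ?_
      exact (Continuous.comp (g := fun q : (RectSlice Ls G × (RectTorusSite Ls → G)) × RectSlice Ls G =>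
          Real.exp (J * rectElecSum (Ls := Ls) ρ q.1.1 q.1.2 q.2))
        (f := fun p : RectSlice Ls G × (RectTorusSite Ls → G) => (p, b))
        (continuous_exp_rectElecSum_pair ρ J hρ) (continuous_id.prodMk continuous_const)).mul continuous_const
  have hFb : ∀ a E, ‖F a E‖ ≤ CE * ∫ b, |h b| ∂(rectSliceMeasure G Ls) := by
    intro a E
    simp only [hF]
    rw [← integral_const_mul]
    refine norm_integral_le_of_norm_le (hhi.abs.const_mul _) (Eventually.of_forall fun b => ?_)
    rw [norm_mul, Real.norm_of_nonneg (hexp_nn _ _ _), Real.norm_eq_abs]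
    exact mul_le_mul_of_nonneg_right (hexp_le _ _ _) (abs_nonneg _)
  have hstep2 : ∫ a, (φ : RectSlice Ls G → ℝ) a * (m a * ∫ E, F a E ∂(Measure.pi fun _ : RectTorusSite Ls => haarProbability G)) ∂(rectSliceMeasure G Ls) =
      ∫ E, ∫ a, ((φ : RectSlice Ls G → ℝ) a * m a) * F a E ∂(rectSliceMeasure G Ls) ∂(Measure.pi fun _ : RectTorusSite Ls => haarProbability G) := by
    have h1 : ∀ a, (φ : RectSlice Ls G → ℝ) a * (m a * ∫ E, F a E ∂(Measure.pi fun _ : RectTorusSite Ls => haarProbability G)) =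
        ∫ E, ((φ : RectSlice Ls G → ℝ) a * m a) * F a E ∂(Measure.pi fun _ : RectTorusSite Ls => haarProbability G) := fun a => by
      rw [← mul_assoc, ← integral_const_mul]
    simp_rw [h1]
    have hint : Integrable (uncurry fun (a : RectSlice Ls G) (E : RectTorusSite Ls → G) =>
        ((φ : RectSlice Ls G → ℝ) a * m a) * F a E) ((rectSliceMeasure G Ls).prod (Measure.pi fun _ : RectTorusSite Ls => haarProbability G)) := by
      have h0 : Integrable (fun p : RectSlice Ls G × (RectTorusSite Ls → G) =>
          ((φ : RectSlice Ls G → ℝ) p.1 * m p.1) * (1 : ℝ)) ((rectSliceMeasure G Ls).prod (Measure.pi fun _ : RectTorusSite Ls => haarProbability G)) := hφmi.mul_prod (integrable_const 1)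
      have h0' := h0.mul_bdd hFc.aestronglyMeasurable (c := CE * ∫ b, |h b| ∂(rectSliceMeasure G Ls))
        (Eventually.of_forall fun p => hFb p.1 p.2)
      refine h0'.congr (Eventually.of_forall fun p => ?_)
      simp only [uncurry, mul_one]
    exact integral_integral_swap hint
  rw [hstep2]
  -- Step 3: for each `E`, absorb the temporal links into `φ`
  have hstep3 : ∀ E : RectTorusSite Ls → G, ∫ a, ((φ : RectSlice Ls G → ℝ) a * m a) * F a E ∂(rectSliceMeasure G Ls) =
      ∫ a, ((φ : RectSlice Ls G → ℝ) a * m a) * F a 1 ∂(rectSliceMeasure G Ls) := by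
    intro E
    have hmp : MeasurePreserving
        (fun (U : RectSlice Ls G) (e : RectTorusSite Ls × Fin k) => E e.1 * U e * (E (e.1 + Pi.single e.2 1))⁻¹)
        (rectSliceMeasure G Ls) (rectSliceMeasure G Ls) := measurePreserving_rectGauge E
    set Ψ : RectSlice Ls G → ℝ := fun a => ((φ : RectSlice Ls G → ℝ) a * m a) * F a E with hΨ
    have hFE : Continuous fun a : RectSlice Ls G => F a E :=
      Continuous.comp (g := uncurry F) (f := fun a : RectSlice Ls G => (a, E)) hFc
        (continuous_id.prodMk continuous_const)
    have hΨm : AEStronglyMeasurable Ψ (rectSliceMeasure G Ls) :=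
      ((Lp.aestronglyMeasurable φ).mul hmc.aestronglyMeasurable).mul hFE.aestronglyMeasurable
    -- `∫ Ψ = ∫ Ψ ∘ (·)^E`
    have h1 : ∫ a, Ψ a ∂(rectSliceMeasure G Ls) =
        ∫ a, Ψ (fun e => E e.1 * a e * (E (e.1 + Pi.single e.2 1))⁻¹) ∂(rectSliceMeasure G Ls) := by
      have hΨm' : AEStronglyMeasurable Ψ (Measure.map
          (fun (U : RectSlice Ls G) (e : RectTorusSite Ls × Fin k) => E e.1 * U e * (E (e.1 + Pi.single e.2 1))⁻¹)
          (rectSliceMeasure G Ls)) := by rw [hmp.map_eq]; exact hΨm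
      have h := integral_map hmp.measurable.aemeasurable hΨm'
      rw [hmp.map_eq] at h
      exact h
    rw [h1]
    refine integral_congr_ae ?_
    filter_upwards [hφ E] with a ha
    simp only [hΨ, hF, hm]
    rw [ha, rectMagSum_gauge]
    simp_rw [rectElecSum_gauge_left_self ρ E a]
  simp_rw [hstep3]
  rw [integral_const, probReal_univ, one_smul]
  -- Step 4: the weight at `E = 1` is the product of one-link weights
  refine integral_congr_ae (Eventually.of_forall fun a => ?_)
  simp only [hF, hh, hm]
  simp_rw [exp_rectElecSum_one_eq_prod ρ J a]

/-! ### The vacuum lower bound `‖T‖ ≥ e^{−|J| n P} c₀^N` -/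

/-- **`e^{−|J| n P} c₀^N ≤ ‖T‖`** (`c₀ = ∫ e^{J Re tr ρ}`, `N` links, `P` plaquettes; unitary continuous `ρ`,
`n ≠ 0`): the constant test function `e^{−J mag/2}` — the empty Polyakov path. [cite: MontvayMunster1994, §3.2.6] -/
theorem norm_rectTubeTransferOperator_ge (hρ : Continuous ρ) (hρu : ∀ g, ρ g ∈ Matrix.unitaryGroup (Fin n) ℂ) (hn : n ≠ 0)
    {lam : ℝ}
    (hM : ∀ i j, ∫ c, (Real.exp (J * (ρ c).trace.re) : ℂ) * ρ c i j ∂haarProbability G = if i = j then (lam : ℂ) else 0) :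
    Real.exp (-(|J| * (n * (Fintype.card (RectTorusSite Ls) * Fintype.card {p : Fin k × Fin k // p.1 < p.2})))) *
        (∫ g, Real.exp (J * (ρ g).trace.re) ∂haarProbability G) ^ Fintype.card (RectTorusSite Ls × Fin k) ≤
      ‖rectTubeTransferOperator ρ J Ls‖ := by
  set ℓ : Fin 0 → RectTorusSite Ls × Fin k := Fin.elim0 with hℓ
  set W : RectSlice Ls G → ℝ := fun b => (ρ ((List.ofFn fun t : Fin 0 => b (ℓ t)).prod)).trace.re with hW
  set f : RectSlice Ls G → ℝ := fun b => Real.exp (-(J / 2 * rectMagSum (Ls := Ls) ρ b)) * W b with hf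
  set P : ℝ := n * (Fintype.card (RectTorusSite Ls) * Fintype.card {p : Fin k × Fin k // p.1 < p.2}) with hP
  have hℓinj : Injective ℓ := fun t => Fin.elim0 t
  have hWn : ∀ b, W b = n := fun b => by
    simp only [hW, List.ofFn_zero, List.prod_nil, map_one, Matrix.trace_one, Fintype.card_fin, Complex.natCast_re]
  have hWc : Continuous W := by
    have : W = fun _ => (n : ℝ) := funext hWn
    rw [this]; exact continuous_const
  have hfc : Continuous f :=
    (Real.continuous_exp.comp (continuous_const.mul (continuous_rectMagSum (Ls := Ls) ρ hρ)).neg).mul hWc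
  obtain ⟨Cf, hCf⟩ := isCompact_univ.exists_bound_of_continuousOn hfc.continuousOn
  have hmem : MemLp f 2 (rectSliceMeasure G Ls) :=
    MemLp.of_bound hfc.aestronglyMeasurable Cf (Eventually.of_forall fun b => hCf b (Set.mem_univ _))
  have hWg : ∀ (γ : RectTorusSite Ls → G) (b : RectSlice Ls G),
      (ρ ((List.ofFn fun t : Fin 0 =>
        (fun e : RectTorusSite Ls × Fin k => γ e.1 * b e * (γ (e.1 + Pi.single e.2 1))⁻¹) (ℓ t)).prod)).trace.re =
        (ρ ((List.ofFn fun t : Fin 0 => b (ℓ t)).prod)).trace.re := fun γ b => by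
    simp only [List.ofFn_zero]
  have hinner := inner_rectTubeTransferOperator_pathState ρ J hρ hM ℓ hℓinj hWg hmem
  simp only [Nat.sub_zero, pow_zero, mul_one] at hinner
  -- `‖ψ‖² ≤ e^{|J| P} ∫ W²`
  have hW2i : Integrable (fun b => W b ^ 2) (rectSliceMeasure G Ls) :=
    (hWc.pow 2).integrable_of_hasCompactSupport (HasCompactSupport.of_compactSpace _)
  have hnorm : ‖hmem.toLp f‖ ^ 2 ≤ Real.exp (|J| * P) * ∫ b, W b ^ 2 ∂(rectSliceMeasure G Ls) := by
    rw [norm_sq_eq_integral_sq, ← integral_const_mul]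
    have hae := hmem.coeFn_toLp
    refine integral_mono_ae ((Lp.memLp (hmem.toLp f)).integrable_sq) (hW2i.const_mul _) ?_
    filter_upwards [hae] with b hb
    rw [hb]
    simp only [hf]
    rw [mul_pow, ← Real.exp_nat_mul]
    have h2 : ((2 : ℕ) : ℝ) * -(J / 2 * rectMagSum (Ls := Ls) ρ b) = -(J * rectMagSum (Ls := Ls) ρ b) := by
      push_cast; ring
    rw [h2]
    exact mul_le_mul_of_nonneg_right (exp_neg_rectMagSum_le ρ J hρu b) (sq_nonneg _)
  -- `⟪ψ, Tψ⟫ ≤ ‖T‖ ‖ψ‖²`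
  have hle : (∫ g, Real.exp (J * (ρ g).trace.re) ∂haarProbability G) ^ Fintype.card (RectTorusSite Ls × Fin k) *
      ∫ b, W b ^ 2 ∂(rectSliceMeasure G Ls) ≤ ‖rectTubeTransferOperator ρ J Ls‖ * ‖hmem.toLp f‖ ^ 2 := by
    rw [← hinner]
    refine (real_inner_le_norm _ _).trans ?_
    calc ‖hmem.toLp f‖ * ‖rectTubeTransferOperator ρ J Ls (hmem.toLp f)‖
        ≤ ‖hmem.toLp f‖ * (‖rectTubeTransferOperator ρ J Ls‖ * ‖hmem.toLp f‖) :=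
          mul_le_mul_of_nonneg_left (ContinuousLinearMap.le_opNorm _ _) (norm_nonneg _)
      _ = ‖rectTubeTransferOperator ρ J Ls‖ * ‖hmem.toLp f‖ ^ 2 := by ring
  have hT0 : 0 ≤ ‖rectTubeTransferOperator ρ J Ls‖ := norm_nonneg _
  have h3 : (∫ g, Real.exp (J * (ρ g).trace.re) ∂haarProbability G) ^ Fintype.card (RectTorusSite Ls × Fin k) *
      ∫ b, W b ^ 2 ∂(rectSliceMeasure G Ls) ≤
      ‖rectTubeTransferOperator ρ J Ls‖ * (Real.exp (|J| * P) * ∫ b, W b ^ 2 ∂(rectSliceMeasure G Ls)) :=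
    hle.trans (mul_le_mul_of_nonneg_left hnorm hT0)
  have hW2pos : 0 < ∫ b, W b ^ 2 ∂(rectSliceMeasure G Ls) := by
    simp_rw [hWn]
    rw [integral_const, probReal_univ, one_smul]
    exact pow_pos (Nat.cast_pos.2 (Nat.pos_of_ne_zero hn)) 2
  have hexp : 0 < Real.exp (|J| * P) := Real.exp_pos _
  have h4 : (∫ g, Real.exp (J * (ρ g).trace.re) ∂haarProbability G) ^ Fintype.card (RectTorusSite Ls × Fin k) ≤
      ‖rectTubeTransferOperator ρ J Ls‖ * Real.exp (|J| * P) :=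
    le_of_mul_le_mul_right (by nlinarith [h3]) hW2pos
  rw [Real.exp_neg]
  calc (Real.exp (|J| * P))⁻¹ * (∫ g, Real.exp (J * (ρ g).trace.re) ∂haarProbability G) ^ Fintype.card (RectTorusSite Ls × Fin k)
      ≤ (Real.exp (|J| * P))⁻¹ * (‖rectTubeTransferOperator ρ J Ls‖ * Real.exp (|J| * P)) :=
        mul_le_mul_of_nonneg_left h4 (inv_nonneg.2 hexp.le)
    _ = ‖rectTubeTransferOperator ρ J Ls‖ := by field_simp

end Reduction

end Summit.Ventures.YMGap.FlowData
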